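import Mathlib

/-!
# Venture YMGap, track Y3 FLOW-DATA — the second-order PRODUCT REMAINDER of lineage A's «TAIL-2» (ENGINE.md §6.1), typed

HONEST FRAMING: venture file of the cell `pub-ymgap` (QuantumFields programme), track Y3, lineage A (seat flow-eng-1).  Pure
finite algebra over `ℝ` (products over a `Finset` of plaquettes); NO lattice statement, no number of record, nothing about
limits or a mass gap.

TAIL-2 (engine «sntm» v2, ENGINE.md §6.1) writes each normalised plaquette weight as `w_p = a_p + r_p` with `a_p = w_{≤,p}` the kept
characters (`2J ≤ J_c`, built exactly), `r_p = rle_p + rgt_p` (`rle` = characters `J_c < 2J ≤ J_h`, built exactly in the «high-plaquette»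
builds; `rgt` = characters `2J > J_h`), with the sup-norm bounds `|r_p| ≤ τ₁`, `|rgt_p| ≤ τ₂` (`PlaquetteCharacterTail`) and
`|a_p| ≤ w⁺_p`.  The engine builds `W₁ = Π_p a_p + Σ_p rle_p Π_{q ≠ p} a_q` EXACTLY and bounds the remainder pointwise:

* `prod_add_eq_sum_powerset'` — `Π_p (a_p + r_p) = Σ_{A ⊆ s} (Π_{p ∈ A} r_p) Π_{q ∈ s ∖ A} a_q` (Mathlib's `Finset.prod_add`);
* `prod_add_sub_firstOrder_eq` — `Π(a + r) − Π a − Σ_p r_p Π_{q≠p} a_q = Σ_{A ⊆ s, 2 ≤ #A} (Π_A r) Π_{s∖A} a`;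
* ★ `abs_tail2Remainder_le` — `|Π_p (a_p + r_p) − W₁| ≤ F := τ₂ Σ_p Π_{q≠p} w⁺_q + Σ_{A ⊆ s, 2 ≤ #A} τ₁^{#A} Π_{q ∉ A} w⁺_q`
  (ENGINE.md §6.1 verbatim: the `|A| = 1` part of the high tail and all `|A| ≥ 2` cross terms);
* `prod_weight_mem_Icc_W1` — hence `W₁ − F ≤ Π w ≤ W₁ + F` pointwise; with the tree's
  `GalerkinWeightMonotone.posSemidef_weightMatrix_sub` (Galerkin matrices are Loewner-monotone in the weight) this is the operator
  sandwich `G(W₁) − G(F) ⪯ G(Π w) ⪯ G(W₁) + G(F)` of ENGINE.md §6.1, i.e. the hypotheses `hlo`/`hhi` of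
  `RitzDeflation.eigenvalues₀_sandwich` in TAIL-2 mode (the bracket modes were typed before: `RelativeBracket`, `PlaquetteCharacterTail`);
* `highTail_le_const` / `crossTerms_le_const` / `abs_tail2Remainder_le_const` — the engine's constants when `w⁺ ≤ R₊`:
  `F ≤ N τ₂ R₊^{N−1} + Σ_{2≤k≤N} C(N,k) τ₁^k R₊^{N−k}` (`φ₁`, the `pairs: const` term `C(N,2) τ₁² R₊^{N−2}` and `φ₃`), via
  Mathlib's `Finset.sum_powerset_apply_card`; `crossTerms_eq_pairs_add` / `abs_tail2Remainder_le_pairs` — the `pairs: build`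
  form (the `|A| = 2` terms kept as functions, `|A| ≥ 3` bounded by `φ₃`).

References: the cell's HOME/pub-ymgap-flow-eng-1/ENGINE.md §6.1 (2026-08-23); finite product expansion [folklore]; I. Montvay, G. Münster,
*Quantum Fields on a Lattice* (1994) §3.2.6 for the character expansion being truncated [cite: MontvayMunster1994, §3.2.6].
-/

noncomputable section

open Finset
open scoped BigOperators

namespace Summit.Ventures.YMGap.FlowData.Tail2Remainder

variable {ι : Type*} [DecidableEq ι]


/-! ### The finite product expansion and its second-order split -/

omit [DecidableEq ι] in
/-- `Π_{p∈s} (a_p + r_p) = Σ_{A ⊆ s} (Π_{p∈A} r_p) · Π_{q ∈ s∖A} a_q` (Mathlib's `Finset.prod_add`, summands reordered). [folklore] -/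
theorem prod_add_eq_sum_powerset' [DecidableEq ι] (s : Finset ι) (a r : ι → ℝ) :
    ∏ p ∈ s, (a p + r p) = ∑ A ∈ s.powerset, (∏ p ∈ A, r p) * ∏ q ∈ s \ A, a q := by
  have h := Finset.prod_add r a s
  simpa only [add_comm (r _) (a _)] using h

/-- The `#A = 0` and `#A = 1` layers of the powerset sum: `Σ_{A ⊆ s, #A < 2} (Π_A r) Π_{s∖A} a = Π_s a + Σ_{p∈s} r_p Π_{q ∈ s.erase p} a_q`.
[folklore] -/
theorem sum_powerset_card_lt_two (s : Finset ι) (a r : ι → ℝ) :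
    ∑ A ∈ s.powerset with A.card < 2, (∏ p ∈ A, r p) * ∏ q ∈ s \ A, a q
      = ∏ q ∈ s, a q + ∑ p ∈ s, r p * ∏ q ∈ s.erase p, a q := by
  -- the filter is {∅} ∪ {{p} : p ∈ s}
  have hsplit : (s.powerset.filter fun A => A.card < 2) = insert ∅ (s.map ⟨fun p => ({p} : Finset ι), fun _ _ h => singleton_injective h⟩) := by
    ext A
    simp only [mem_filter, mem_powerset, mem_insert, mem_map, Function.Embedding.coeFn_mk]
    constructor
    · rintro ⟨hA, hc⟩
      rcases Nat.lt_succ_iff.mp hc |>.eq_or_lt with h1 | h0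
      · obtain ⟨p, rfl⟩ := card_eq_one.mp h1
        exact Or.inr ⟨p, by simpa using hA, rfl⟩
      · exact Or.inl (card_eq_zero.mp (Nat.lt_one_iff.mp h0))
    · rintro (rfl | ⟨p, hp, rfl⟩)
      · simp
      · simp [hp]
  rw [hsplit, sum_insert, sum_map]
  · simp only [Function.Embedding.coeFn_mk, prod_empty, one_mul, sdiff_empty, prod_singleton, sdiff_singleton_eq_erase]
  · simp only [mem_map, Function.Embedding.coeFn_mk, not_exists, not_and]
    intro p _ h
    exact (singleton_ne_empty p) h

/-- ★ The second-order split: `Π(a + r) − Π a − Σ_p r_p Π_{q≠p} a_q = Σ_{A ⊆ s, 2 ≤ #A} (Π_A r) Π_{s∖A} a`. [folklore] -/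
theorem prod_add_sub_firstOrder_eq (s : Finset ι) (a r : ι → ℝ) :
    ∏ p ∈ s, (a p + r p) - ∏ q ∈ s, a q - ∑ p ∈ s, r p * ∏ q ∈ s.erase p, a q
      = ∑ A ∈ s.powerset with 2 ≤ A.card, (∏ p ∈ A, r p) * ∏ q ∈ s \ A, a q := by
  rw [prod_add_eq_sum_powerset', ← sum_filter_add_sum_filter_not s.powerset (fun A => A.card < 2), sum_powerset_card_lt_two]
  have hnot : (s.powerset.filter fun A => ¬ A.card < 2) = s.powerset.filter fun A => 2 ≤ A.card := by
    refine filter_congr fun A _ => ?_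
    exact not_lt
  rw [hnot]
  ring

/-! ### The pointwise remainder bound of TAIL-2 -/

omit [DecidableEq ι] in
/-- `|Π_{p∈A} r_p| ≤ τ^{#A}` when `|r_p| ≤ τ` on `A`. [folklore] -/
theorem abs_prod_le_pow (A : Finset ι) (r : ι → ℝ) {τ : ℝ} (h : ∀ p ∈ A, |r p| ≤ τ) :
    |∏ p ∈ A, r p| ≤ τ ^ A.card := by
  rw [Finset.abs_prod, ← prod_const]
  exact prod_le_prod (fun p _ => abs_nonneg _) h

omit [DecidableEq ι] in
/-- `|Π_{q∈B} a_q| ≤ Π_{q∈B} w⁺_q` when `|a_q| ≤ w⁺_q` on `B`. [folklore] -/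
theorem abs_prod_le_prod_of_abs_le (B : Finset ι) (a w : ι → ℝ) (h : ∀ q ∈ B, |a q| ≤ w q) :
    |∏ q ∈ B, a q| ≤ ∏ q ∈ B, w q := by
  rw [Finset.abs_prod]
  exact prod_le_prod (fun p _ => abs_nonneg _) h

/-- ★ **The TAIL-2 remainder bound** (ENGINE.md §6.1).  For a finite family of plaquettes `s`, kept parts `a_p`, tails
`r_p = rle_p + rgt_p` with `|r_p| ≤ τ₁`, `|rgt_p| ≤ τ₂` and `|a_p| ≤ w⁺_p` on `s`, the exactly-built first-order quantity
`W₁ = Π_p a_p + Σ_p rle_p Π_{q≠p} a_q` satisfies, POINTWISE,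
`|Π_p (a_p + r_p) − W₁| ≤ τ₂ Σ_p Π_{q≠p} w⁺_q + Σ_{A ⊆ s, 2 ≤ #A} τ₁^{#A} Π_{q∉A} w⁺_q` (=: `F`). [folklore] -/
theorem abs_tail2Remainder_le (s : Finset ι) (a rle rgt w : ι → ℝ) {τ₁ τ₂ : ℝ}
    (h1 : ∀ p ∈ s, |rle p + rgt p| ≤ τ₁) (h2 : ∀ p ∈ s, |rgt p| ≤ τ₂) (ha : ∀ p ∈ s, |a p| ≤ w p) :
    |∏ p ∈ s, (a p + (rle p + rgt p)) - (∏ q ∈ s, a q + ∑ p ∈ s, rle p * ∏ q ∈ s.erase p, a q)|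
      ≤ τ₂ * ∑ p ∈ s, ∏ q ∈ s.erase p, w q
        + ∑ A ∈ s.powerset with 2 ≤ A.card, τ₁ ^ A.card * ∏ q ∈ s \ A, w q := by
  set r : ι → ℝ := fun p => rle p + rgt p with hr
  have hsplit := prod_add_sub_firstOrder_eq s a r
  -- Π(a+r) − W₁ = (second-order sum) + Σ_p rgt_p Π_{q≠p} a_q
  have hdecomp : ∏ p ∈ s, (a p + r p) - (∏ q ∈ s, a q + ∑ p ∈ s, rle p * ∏ q ∈ s.erase p, a q)
      = (∑ A ∈ s.powerset with 2 ≤ A.card, (∏ p ∈ A, r p) * ∏ q ∈ s \ A, a q)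
        + ∑ p ∈ s, rgt p * ∏ q ∈ s.erase p, a q := by
    rw [← hsplit]
    have : ∑ p ∈ s, r p * ∏ q ∈ s.erase p, a q
        = ∑ p ∈ s, rle p * ∏ q ∈ s.erase p, a q + ∑ p ∈ s, rgt p * ∏ q ∈ s.erase p, a q := by
      rw [← sum_add_distrib]
      refine sum_congr rfl fun p _ => ?_
      simp only [hr]; ring
    rw [this]; ring
  rw [hdecomp]
  refine (abs_add_le _ _).trans ?_
  rw [add_comm]
  gcongr
  · -- the |A| = 1 high-tail part
    refine (abs_sum_le_sum_abs _ _).trans ?_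
    rw [mul_sum]
    refine sum_le_sum fun p hp => ?_
    rw [abs_mul]
    have hw : 0 ≤ ∏ q ∈ s.erase p, w q :=
      prod_nonneg fun q hq => (abs_nonneg _).trans (ha q (mem_of_mem_erase hq))
    exact mul_le_mul (h2 p hp) (abs_prod_le_prod_of_abs_le _ a w fun q hq => ha q (mem_of_mem_erase hq))
      (abs_nonneg _) ((abs_nonneg _).trans (h2 p hp))
  · -- the |A| ≥ 2 cross terms
    refine (abs_sum_le_sum_abs _ _).trans ?_
    refine sum_le_sum fun A hA => ?_
    have hAs : A ⊆ s := mem_powerset.mp (mem_filter.mp hA).1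
    rw [abs_mul]
    have hw : 0 ≤ ∏ q ∈ s \ A, w q :=
      prod_nonneg fun q hq => (abs_nonneg _).trans (ha q (mem_sdiff.mp hq).1)
    have hτ : 0 ≤ τ₁ ^ A.card := by
      rcases A.eq_empty_or_nonempty with hE | ⟨p, hp⟩
      · simp [hE]
      · exact pow_nonneg ((abs_nonneg _).trans (h1 p (hAs hp))) _
    exact mul_le_mul (abs_prod_le_pow A r fun p hp => h1 p (hAs hp))
      (abs_prod_le_prod_of_abs_le _ a w fun q hq => ha q (mem_sdiff.mp hq).1) (abs_nonneg _) hτ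

/-- **The pointwise TAIL-2 bracket**: with `F` as in `abs_tail2Remainder_le`, `W₁ − F ≤ Π_p w_p ≤ W₁ + F` at every point
(`w_p = a_p + rle_p + rgt_p`); by `GalerkinWeightMonotone.posSemidef_weightMatrix_sub` (tree) this is the Loewner sandwich
`G(W₁) − G(F) ⪯ G(Π w) ⪯ G(W₁) + G(F)` of ENGINE.md §6.1 for the kept-set Galerkin matrices, i.e. the hypotheses
`hrel_lo`/`hrel_hi` of `RitzDeflation.eigenvalues₀_sandwich` in TAIL-2 mode. [folklore] -/
theorem prod_weight_mem_Icc_W1 (s : Finset ι) (a rle rgt w : ι → ℝ) {τ₁ τ₂ : ℝ}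
    (h1 : ∀ p ∈ s, |rle p + rgt p| ≤ τ₁) (h2 : ∀ p ∈ s, |rgt p| ≤ τ₂) (ha : ∀ p ∈ s, |a p| ≤ w p) :
    ∏ p ∈ s, (a p + (rle p + rgt p)) ∈ Set.Icc
      ((∏ q ∈ s, a q + ∑ p ∈ s, rle p * ∏ q ∈ s.erase p, a q)
        - (τ₂ * ∑ p ∈ s, ∏ q ∈ s.erase p, w q + ∑ A ∈ s.powerset with 2 ≤ A.card, τ₁ ^ A.card * ∏ q ∈ s \ A, w q))
      ((∏ q ∈ s, a q + ∑ p ∈ s, rle p * ∏ q ∈ s.erase p, a q)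
        + (τ₂ * ∑ p ∈ s, ∏ q ∈ s.erase p, w q + ∑ A ∈ s.powerset with 2 ≤ A.card, τ₁ ^ A.card * ∏ q ∈ s \ A, w q)) := by
  have h := abs_sub_le_iff.1 (abs_tail2Remainder_le s a rle rgt w h1 h2 ha)
  constructor <;> linarith [h.1, h.2]

/-! ### The engine's constants: bounding the cross terms by binomial sums (ENGINE.md §6.1, modes `pairs: const` / `φ₁ + φ₃`) -/

omit [DecidableEq ι] in
/-- `Π_{q∈B} w_q ≤ R^{#B}` when `0 ≤ w_q ≤ R` on `B`. [folklore] -/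
theorem prod_weight_le_pow_card (B : Finset ι) (w : ι → ℝ) {R : ℝ} (hw0 : ∀ q ∈ B, 0 ≤ w q) (hwR : ∀ q ∈ B, w q ≤ R) :
    ∏ q ∈ B, w q ≤ R ^ B.card := by
  rw [← prod_const]
  exact prod_le_prod hw0 hwR

/-- The `|A| = 1` high-tail constant `φ₁`: `τ₂ Σ_{p∈s} Π_{q≠p} w_q ≤ #s · τ₂ · R^{#s − 1}` when `0 ≤ w ≤ R` on `s`, `0 ≤ τ₂`.
[folklore] -/
theorem highTail_le_const (s : Finset ι) (w : ι → ℝ) {R τ₂ : ℝ} (hτ : 0 ≤ τ₂) (hw0 : ∀ q ∈ s, 0 ≤ w q)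
    (hwR : ∀ q ∈ s, w q ≤ R) :
    τ₂ * ∑ p ∈ s, ∏ q ∈ s.erase p, w q ≤ s.card * τ₂ * R ^ (s.card - 1) := by
  have h : ∀ p ∈ s, ∏ q ∈ s.erase p, w q ≤ R ^ (s.card - 1) := by
    intro p hp
    have := prod_weight_le_pow_card (s.erase p) w (fun q hq => hw0 q (mem_of_mem_erase hq)) (fun q hq => hwR q (mem_of_mem_erase hq))
    rwa [card_erase_of_mem hp] at this
  calc τ₂ * ∑ p ∈ s, ∏ q ∈ s.erase p, w q ≤ τ₂ * ∑ p ∈ s, R ^ (s.card - 1) :=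
        mul_le_mul_of_nonneg_left (sum_le_sum h) hτ
    _ = s.card * τ₂ * R ^ (s.card - 1) := by rw [sum_const, nsmul_eq_mul]; ring

/-- The cross-term constants: for any order `k₀`, `Σ_{A ⊆ s, k₀ ≤ #A} τ₁^{#A} Π_{q∉A} w_q ≤ Σ_{k ≤ #s, k₀ ≤ k} C(#s, k) τ₁^k R^{#s−k}`
when `0 ≤ w ≤ R` on `s` and `0 ≤ τ₁` (`k₀ = 2`: the engine's `C(N,2) τ₁² R₊^{N−2} + φ₃` of `pairs: const`; `k₀ = 3`: `φ₃` alone,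
the `|A| = 2` terms being BUILT in `pairs: build`). [folklore] -/
theorem crossTerms_le_const (s : Finset ι) (w : ι → ℝ) {R τ₁ : ℝ} (hτ : 0 ≤ τ₁) (hw0 : ∀ q ∈ s, 0 ≤ w q)
    (hwR : ∀ q ∈ s, w q ≤ R) (k₀ : ℕ) :
    ∑ A ∈ s.powerset with k₀ ≤ A.card, τ₁ ^ A.card * ∏ q ∈ s \ A, w q
      ≤ ∑ k ∈ range (s.card + 1) with k₀ ≤ k, (s.card.choose k : ℝ) * (τ₁ ^ k * R ^ (s.card - k)) := by
  -- termwise: Π_{s∖A} w ≤ R^{#s − #A}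
  have hterm : ∀ A ∈ s.powerset.filter (fun A => k₀ ≤ A.card),
      τ₁ ^ A.card * ∏ q ∈ s \ A, w q ≤ τ₁ ^ A.card * R ^ (s.card - A.card) := by
    intro A hA
    have hAs : A ⊆ s := mem_powerset.mp (mem_filter.mp hA).1
    refine mul_le_mul_of_nonneg_left ?_ (pow_nonneg hτ _)
    have := prod_weight_le_pow_card (s \ A) w (fun q hq => hw0 q (mem_sdiff.mp hq).1) (fun q hq => hwR q (mem_sdiff.mp hq).1)
    rwa [card_sdiff_of_subset hAs] at this
  refine (sum_le_sum hterm).trans (le_of_eq ?_)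
  -- regroup by cardinality
  rw [sum_filter, sum_filter]
  have h := Finset.sum_powerset_apply_card (fun k => if k₀ ≤ k then τ₁ ^ k * R ^ (s.card - k) else 0) (x := s)
  simp only [nsmul_eq_mul] at h
  rw [h]
  refine sum_congr rfl fun k _ => ?_
  split_ifs <;> simp

/-- Splitting off the pair terms: `Σ_{2 ≤ #A} = Σ_{#A = 2} + Σ_{3 ≤ #A}` for the cross terms (the engine's `pairs: build` keeps the
`|A| = 2` terms as FUNCTIONS — six direct two-plaquette builds on `2×2` — and bounds only `|A| ≥ 3` by the constant `φ₃`). [folklore] -/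
theorem crossTerms_eq_pairs_add (s : Finset ι) (w : ι → ℝ) (τ₁ : ℝ) :
    ∑ A ∈ s.powerset with 2 ≤ A.card, τ₁ ^ A.card * ∏ q ∈ s \ A, w q
      = ∑ A ∈ s.powerset with A.card = 2, τ₁ ^ 2 * ∏ q ∈ s \ A, w q
        + ∑ A ∈ s.powerset with 3 ≤ A.card, τ₁ ^ A.card * ∏ q ∈ s \ A, w q := by
  rw [← sum_filter_add_sum_filter_not (s.powerset.filter fun A => 2 ≤ A.card) (fun A => A.card = 2)]
  congr 1
  · rw [filter_filter]
    have : (s.powerset.filter fun A => 2 ≤ A.card ∧ A.card = 2) = s.powerset.filter fun A => A.card = 2 :=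
      filter_congr fun A _ => ⟨fun h => h.2, fun h => ⟨h.symm.le, h⟩⟩
    rw [this]
    exact sum_congr rfl fun A hA => by rw [(mem_filter.mp hA).2]
  · rw [filter_filter]
    have : (s.powerset.filter fun A => 2 ≤ A.card ∧ ¬ A.card = 2) = s.powerset.filter fun A => 3 ≤ A.card :=
      filter_congr fun A _ => by omega
    rw [this]

/-- **TAIL-2 with the engine's constants** (ENGINE.md §6.1, `pairs: const`): under `|r_p| ≤ τ₁`, `|rgt_p| ≤ τ₂`, `|a_p| ≤ w⁺_p ≤ R₊`
on `s` (`N = #s` plaquettes), `|Π_p w_p − W₁| ≤ N τ₂ R₊^{N−1} + Σ_{2 ≤ k ≤ N} C(N,k) τ₁^k R₊^{N−k}`. [folklore] -/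
theorem abs_tail2Remainder_le_const (s : Finset ι) (a rle rgt w : ι → ℝ) {τ₁ τ₂ R : ℝ} (hτ₁ : 0 ≤ τ₁) (hτ₂ : 0 ≤ τ₂)
    (h1 : ∀ p ∈ s, |rle p + rgt p| ≤ τ₁) (h2 : ∀ p ∈ s, |rgt p| ≤ τ₂) (ha : ∀ p ∈ s, |a p| ≤ w p)
    (hwR : ∀ p ∈ s, w p ≤ R) :
    |∏ p ∈ s, (a p + (rle p + rgt p)) - (∏ q ∈ s, a q + ∑ p ∈ s, rle p * ∏ q ∈ s.erase p, a q)|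
      ≤ s.card * τ₂ * R ^ (s.card - 1)
        + ∑ k ∈ range (s.card + 1) with 2 ≤ k, (s.card.choose k : ℝ) * (τ₁ ^ k * R ^ (s.card - k)) := by
  have hw0 : ∀ q ∈ s, 0 ≤ w q := fun q hq => (abs_nonneg _).trans (ha q hq)
  exact (abs_tail2Remainder_le s a rle rgt w h1 h2 ha).trans
    (add_le_add (highTail_le_const s w hτ₂ hw0 hwR) (crossTerms_le_const s w hτ₁ hw0 hwR 2))

/-- **TAIL-2 in `pairs: build` mode** (ENGINE.md §6.1): the `|A| = 2` cross terms kept as functions (built), the rest constants: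
`|Π_p w_p − W₁| ≤ N τ₂ R₊^{N−1} + τ₁² Σ_{#A=2} Π_{q∉A} w⁺_q + Σ_{3 ≤ k ≤ N} C(N,k) τ₁^k R₊^{N−k}`. [folklore] -/
theorem abs_tail2Remainder_le_pairs (s : Finset ι) (a rle rgt w : ι → ℝ) {τ₁ τ₂ R : ℝ} (hτ₁ : 0 ≤ τ₁) (hτ₂ : 0 ≤ τ₂)
    (h1 : ∀ p ∈ s, |rle p + rgt p| ≤ τ₁) (h2 : ∀ p ∈ s, |rgt p| ≤ τ₂) (ha : ∀ p ∈ s, |a p| ≤ w p)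
    (hwR : ∀ p ∈ s, w p ≤ R) :
    |∏ p ∈ s, (a p + (rle p + rgt p)) - (∏ q ∈ s, a q + ∑ p ∈ s, rle p * ∏ q ∈ s.erase p, a q)|
      ≤ s.card * τ₂ * R ^ (s.card - 1)
        + (∑ A ∈ s.powerset with A.card = 2, τ₁ ^ 2 * ∏ q ∈ s \ A, w q
          + ∑ k ∈ range (s.card + 1) with 3 ≤ k, (s.card.choose k : ℝ) * (τ₁ ^ k * R ^ (s.card - k))) := by
  have hw0 : ∀ q ∈ s, 0 ≤ w q := fun q hq => (abs_nonneg _).trans (ha q hq)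
  refine (abs_tail2Remainder_le s a rle rgt w h1 h2 ha).trans (add_le_add (highTail_le_const s w hτ₂ hw0 hwR) ?_)
  rw [crossTerms_eq_pairs_add]
  exact add_le_add le_rfl (crossTerms_le_const s w hτ₁ hw0 hwR 3)

end Summit.Ventures.YMGap.FlowData.Tail2Remainder

end
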